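import Literature.NumberTheory.GaloisRepresentations.SorensenPatching
import HarnessLib

/-!
# Towers and composita in `Γ_F`: the printed form of hypothesis (b) of Sorensen's patching lemma

Topic `Literature/NumberTheory/GaloisRepresentations`.  Complements `SorensenPatching`
(Sorensen, *A patching lemma*, § 1, Lemma 2, proved there as `exists_framedGaloisRep`) by
deriving its hypothesis (b), stated there intrinsically in `Γ_F` ("one matrix conjugates
`ρ_i(x)` to `ρ_j(y)` whenever `res x = res y`"), from the printed form
"`ρ_E|_{Γ_{EE'}} ≃ ρ_{E'}|_{Γ_{EE'}}`" — an equivalence of the restrictions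
(`FramedGaloisRep.restrictField`) to the absolute Galois group of a compositum `L = EE'` — given
the Galois invariance (a).  Everything is elementary Galois theory of the absolute Galois group
(restriction maps between absolute Galois groups are canonical up to inner automorphisms;
Milne, *Fields and Galois Theory*, Ch. 7), proved from the tree's
`absGaloisRestrict_isConj_of_algHom_holds` and `AbsGaloisOuterConj`:

* `exists_absGaloisRestrict_absGaloisRestrict_eq_conj` — for a tower `F ⊆ E ⊆ L`,
  `res_{E/F} ∘ res_{L/E} = τ · res_{L/F} · τ⁻¹` for some `τ ∈ Γ_F`; hence
  `nonempty_equiv_restrictField_restrictField`: `(ρ|_{Γ_E})|_{Γ_L} ≃ ρ|_{Γ_L}`.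
* `fieldRange_eq_fieldRange_of_normal` — embeddings of a normal extension have the same image.
* `range_absGaloisRestrict_eq_inf_of_sup_eq_top` — **`Γ_{E₁E₂} = Γ_{E₁} ∩ Γ_{E₂}`** in `Γ_F`
  (exactly) for normal `E₁, E₂` with compositum `L` (hypothesis: `L` is generated by the images
  of `E₁` and `E₂`), via Mathlib `IntermediateField.fixingSubgroup_sup`.
* `exists_conj_of_equiv_restrictField` — **(a) for `ρ₁, ρ₂` and `ρ₁|_{Γ_L} ≃ ρ₂|_{Γ_L}` imply
  the intrinsic (b)**.

With `SorensenPatching.exists_framedGaloisRep` this gives Lemma 2 with both hypotheses in their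
printed form, (a) as `FramedGaloisRep.outerConj τ ρ ≃ ρ` and (b) over composita.

## References

* C. M. Sorensen, *A patching lemma*, in: Shimura Varieties, LMS Lecture Note Ser. 457
  (2020), § 1, conditions (a), (b) and Lemma 2. [Sorensen2020]
* J. S. Milne, *Fields and Galois Theory* (v4.60), Ch. 7. [MilneFT2022]
* J. Neukirch, *Algebraic Number Theory* (1999), Ch. IV § 1. [NeukirchANT1999]
-/

noncomputable section

open scoped MatrixGroups Matrix NumberField
open Field Topology

namespace Literature.NumberTheory.GaloisRepresentations

namespace SorensenPatching

/-! ### Towers `F ⊆ E ⊆ L`: `res_{L/F} = res_{E/F} ∘ res_{L/E}` up to conjugation -/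

section Tower

variable (F E L : Type*) [Field F] [Field E] [Field L] [Algebra F E] [Algebra E L] [Algebra F L]
  [IsScalarTower F E L]

/-- **Transitivity of restriction up to conjugacy.**  For a tower `F ⊆ E ⊆ L` the composite of
the restriction maps `Γ_L → Γ_E → Γ_F` (each defined through its own chosen isomorphism of
algebraic closures) differs from `Γ_L → Γ_F` by an inner automorphism of `Γ_F`
(`absGaloisRestrict_isConj_of_algHom_holds`: restriction is well defined up to conjugacy).
Ref: Milne, *Fields and Galois Theory*, Ch. 7 (the absolute Galois group). [folklore] -/
theorem exists_absGaloisRestrict_absGaloisRestrict_eq_conj :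
    ∃ τ : absoluteGaloisGroup F, ∀ σ : absoluteGaloisGroup L,
      absGaloisRestrict F E (absGaloisRestrict E L σ) = τ * absGaloisRestrict F L σ * τ⁻¹ := by
  refine absGaloisRestrict_isConj_of_algHom_holds F L
    (((absClosureEmbedding E L).restrictScalars F).comp (absClosureEmbedding F E))
    (fun σ => absGaloisRestrict F E (absGaloisRestrict E L σ)) (fun σ x => ?_)
  change absClosureEmbedding E L (absClosureEmbedding F E (_ • x)) =
    σ • absClosureEmbedding E L (absClosureEmbedding F E x)
  rw [absGaloisRestrict_apply_smul, absGaloisRestrict_apply_smul]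

variable {A : Type*} [CommRing A] [TopologicalSpace A] [IsTopologicalRing A] {n : ℕ}

/-- **`(ρ|_{Γ_E})|_{Γ_L} ≃ ρ|_{Γ_L}`** for a framed Galois representation `ρ` of `Γ_F` and a
tower `F ⊆ E ⊆ L`: the two differ by the change of frame `ρ(τ)`, `τ` as in
`exists_absGaloisRestrict_absGaloisRestrict_eq_conj`. [folklore] -/
theorem nonempty_equiv_restrictField_restrictField (ρ : FramedGaloisRep F A n) :
    Nonempty (ContinuousRep.Equiv (ρ.restrictField L).toGaloisRep
      ((ρ.restrictField E).restrictField L).toGaloisRep) := by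
  obtain ⟨τ, hτ⟩ := exists_absGaloisRestrict_absGaloisRestrict_eq_conj F E L
  refine ⟨FramedRep.equivOfEqConj _ _ (ρ τ) fun σ => ?_⟩
  simp only [FramedGaloisRep.restrictField_apply, hτ, map_mul, map_inv]

end Tower

/-! ### Images of normal extensions; `res(Γ_L) = res(Γ_{E₁}) ∩ res(Γ_{E₂})` for a compositum -/

section Normal

variable {F E K : Type*} [Field F] [Field E] [Field K] [Algebra F E] [Algebra F K]

/-- Two `F`-embeddings of a **normal** extension `E/F` into any extension `K/F` have the same
image (Mathlib `AlgHom.fieldRange_of_normal`, for intermediate fields). [folklore] -/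
theorem fieldRange_eq_fieldRange_of_normal [Normal F E] (f g : E →ₐ[F] K) :
    f.fieldRange = g.fieldRange := by
  have key : ∀ f g : E →ₐ[F] K, g.fieldRange ≤ f.fieldRange := by
    intro f g
    haveI : Normal F f.fieldRange := Normal.of_algEquiv f.equivFieldRange
    have h := AlgHom.fieldRange_of_normal (g.comp f.equivFieldRange.symm.toAlgHom)
    intro z hz
    obtain ⟨x, rfl⟩ := AlgHom.mem_fieldRange.1 hz
    rw [← h]
    exact ⟨f.equivFieldRange x, by simp⟩
  exact le_antisymm (key g f) (key f g)

end Normal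

section Compositum

variable (F M : Type*) [Field F] [Field M] [Algebra F M] [Algebra.IsAlgebraic F M]

/-- `res(Γ_M) ≤ Γ_F` consists of the elements fixing the subfield `e(M) ⊆ F̄`
(`mem_range_absGaloisRestrict_iff_smul_absEmbedding`), i.e. it is the fixing subgroup of
`(absEmbedding F M).fieldRange` under `Γ_F = Aut(F̄/F)`. [folklore] -/
theorem mem_range_absGaloisRestrict_iff_mem_fixingSubgroup (g : absoluteGaloisGroup F) :
    g ∈ (absGaloisRestrict F M).range ↔
      absoluteGaloisGroup.toAlgEquiv F g ∈ (absEmbedding F M).fieldRange.fixingSubgroup := by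
  rw [mem_range_absGaloisRestrict_iff_smul_absEmbedding, IntermediateField.mem_fixingSubgroup_iff]
  constructor
  · rintro h _ ⟨x, rfl⟩
    exact h x
  · intro h x
    exact h _ ⟨x, rfl⟩

variable {F M}
variable (E₁ E₂ L : Type*) [Field E₁] [Field E₂] [Field L] [Algebra F E₁] [Algebra F E₂]
  [Algebra F L] [Algebra E₁ L] [Algebra E₂ L] [IsScalarTower F E₁ L] [IsScalarTower F E₂ L]
  [Algebra.IsAlgebraic F L] [Normal F E₁] [Normal F E₂]

/-- **`Γ_{E₁E₂} = Γ_{E₁} ∩ Γ_{E₂}` inside `Γ_F`.**  If `L` is generated over `F` by the images of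
two normal subextensions `E₁, E₂` (a compositum `E₁E₂`), then
`res(Γ_L) = res(Γ_{E₁}) ∩ res(Γ_{E₂})` as subgroups of `Γ_F` — exactly, not only up to
conjugacy: the subfields `e(E_i) ⊆ F̄` do not depend on the embedding (normality,
`fieldRange_eq_fieldRange_of_normal`), `e_L(L) = e_L(E₁) e_L(E₂)`, and fixing subgroups turn
`⊔` into `⊓` (Mathlib `IntermediateField.fixingSubgroup_sup`).
Ref: Neukirch, *Algebraic Number Theory*, Ch. IV §1. [folklore] -/
theorem range_absGaloisRestrict_eq_inf_of_sup_eq_top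
    (hcomp : (IsScalarTower.toAlgHom F E₁ L).fieldRange ⊔ (IsScalarTower.toAlgHom F E₂ L).fieldRange = ⊤) :
    (absGaloisRestrict F L).range =
      (absGaloisRestrict F E₁).range ⊓ (absGaloisRestrict F E₂).range := by
  haveI : Algebra.IsAlgebraic F E₁ := Algebra.IsAlgebraic.of_injective
    (IsScalarTower.toAlgHom F E₁ L) (IsScalarTower.toAlgHom F E₁ L).injective
  haveI : Algebra.IsAlgebraic F E₂ := Algebra.IsAlgebraic.of_injective
    (IsScalarTower.toAlgHom F E₂ L) (IsScalarTower.toAlgHom F E₂ L).injective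
  -- `e_L(L) = e(E₁) ⊔ e(E₂)` in `F̄`
  have hK : (absEmbedding F L).fieldRange =
      (absEmbedding F E₁).fieldRange ⊔ (absEmbedding F E₂).fieldRange := by
    rw [AlgHom.fieldRange_eq_map, ← hcomp, IntermediateField.map_sup, AlgHom.map_fieldRange,
      AlgHom.map_fieldRange,
      fieldRange_eq_fieldRange_of_normal ((absEmbedding F L).comp (IsScalarTower.toAlgHom F E₁ L))
        (absEmbedding F E₁),
      fieldRange_eq_fieldRange_of_normal ((absEmbedding F L).comp (IsScalarTower.toAlgHom F E₂ L))
        (absEmbedding F E₂)]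
  ext g
  rw [Subgroup.mem_inf, mem_range_absGaloisRestrict_iff_mem_fixingSubgroup,
    mem_range_absGaloisRestrict_iff_mem_fixingSubgroup,
    mem_range_absGaloisRestrict_iff_mem_fixingSubgroup, hK, IntermediateField.fixingSubgroup_sup,
    Subgroup.mem_inf]

end Compositum

/-! ### Hypothesis (b) from an equivalence over the compositum -/

section Bridge

variable {F : Type*} [Field F] {E₁ E₂ L : Type*} [Field E₁] [Field E₂] [Field L]
  [Algebra F E₁] [Algebra F E₂] [Algebra F L] [Algebra E₁ L] [Algebra E₂ L]
  [IsScalarTower F E₁ L] [IsScalarTower F E₂ L] [Algebra.IsAlgebraic F L]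
  [IsGalois F E₁] [IsGalois F E₂] [CharZero E₁] [CharZero E₂]
  {A : Type*} [CommRing A] [TopologicalSpace A] [IsTopologicalRing A] {n : ℕ}

/-- **Hypothesis (b) of the patching lemma from the printed one.**  Let `E₁, E₂` be Galois over
`F` with compositum `L = E₁E₂` (generated by their images), and `ρ_i : Γ_{E_i} → GL_n(A)` framed
Galois representations which are Galois invariant — (a): `ρ_i^τ ≃ ρ_i` for all `τ ∈ Γ_F` — and
equivalent on `Γ_L`: `ρ₁|_{Γ_L} ≃ ρ₂|_{Γ_L}` (the printed (b), `FramedGaloisRep.restrictField`).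
Then one matrix conjugates `ρ₁(x)` to `ρ₂(y)` whenever `x ∈ Γ_{E₁}`, `y ∈ Γ_{E₂}` have the same
image in `Γ_F` (the intrinsic form of (b) used by `exists_framedGaloisRep`).  Proof: the common
image lies in `res(Γ_L) = res(Γ_{E₁}) ∩ res(Γ_{E₂})`
(`range_absGaloisRestrict_eq_inf_of_sup_eq_top`), and `res_{E_i/F} ∘ res_{L/E_i}` is
`res_{L/F}` up to a fixed conjugation (`exists_absGaloisRestrict_absGaloisRestrict_eq_conj`),
absorbed by (a). [folklore] -/
theorem exists_conj_of_equiv_restrictField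
    (hcomp : (IsScalarTower.toAlgHom F E₁ L).fieldRange ⊔ (IsScalarTower.toAlgHom F E₂ L).fieldRange = ⊤)
    (ρ₁ : FramedGaloisRep E₁ A n) (ρ₂ : FramedGaloisRep E₂ A n)
    (ha₁ : ∀ τ : absoluteGaloisGroup F,
      Nonempty (ContinuousRep.Equiv (ρ₁.outerConj τ).toGaloisRep ρ₁.toGaloisRep))
    (ha₂ : ∀ τ : absoluteGaloisGroup F,
      Nonempty (ContinuousRep.Equiv (ρ₂.outerConj τ).toGaloisRep ρ₂.toGaloisRep))
    (h : Nonempty (ContinuousRep.Equiv (ρ₁.restrictField L).toGaloisRep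
      (ρ₂.restrictField L).toGaloisRep)) :
    ∃ P : GL (Fin n) A, ∀ (x : absoluteGaloisGroup E₁) (y : absoluteGaloisGroup E₂),
      absGaloisRestrict F E₁ x = absGaloisRestrict F E₂ y → ρ₂ y = P * ρ₁ x * P⁻¹ := by
  haveI : Algebra.IsAlgebraic E₁ L := Algebra.IsAlgebraic.tower_top (K := F) E₁
  haveI : Algebra.IsAlgebraic E₂ L := Algebra.IsAlgebraic.tower_top (K := F) E₂
  obtain ⟨τ₁, hτ₁⟩ := exists_absGaloisRestrict_absGaloisRestrict_eq_conj F E₁ L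
  obtain ⟨τ₂, hτ₂⟩ := exists_absGaloisRestrict_absGaloisRestrict_eq_conj F E₂ L
  obtain ⟨M₁, hM₁⟩ := FramedRep.exists_eq_conj_of_equiv _ _ (Classical.choice (ha₁ τ₁⁻¹))
  obtain ⟨M₂, hM₂⟩ := FramedRep.exists_eq_conj_of_equiv _ _ (Classical.choice (ha₂ τ₂⁻¹))
  obtain ⟨Q, hQ⟩ := FramedRep.exists_eq_conj_of_equiv _ _ (Classical.choice h)
  -- `ρ₁ = M₁ ρ₁^{τ₁⁻¹} M₁⁻¹`, `ρ₂ = M₂ ρ₂^{τ₂⁻¹} M₂⁻¹`, `ρ₂|_L = Q ρ₁|_L Q⁻¹`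
  refine ⟨M₂⁻¹ * Q * M₁, fun x y hxy => ?_⟩
  -- the common image is `res_{L/F} σ`
  have hmem : absGaloisRestrict F E₁ x ∈ (absGaloisRestrict F L).range := by
    rw [range_absGaloisRestrict_eq_inf_of_sup_eq_top E₁ E₂ L hcomp]
    exact ⟨⟨x, rfl⟩, ⟨y, hxy.symm⟩⟩
  obtain ⟨σ, hσ⟩ := hmem
  change absGaloisRestrict F L σ = absGaloisRestrict F E₁ x at hσ
  -- `x = θ_{τ₁⁻¹}(res_{L/E₁} σ)` and `y = θ_{τ₂⁻¹}(res_{L/E₂} σ)`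
  have hx : x = absGaloisOuterConj F E₁ τ₁⁻¹ (absGaloisRestrict E₁ L σ) := by
    apply absGaloisRestrict_injective F E₁
    rw [absGaloisRestrict_absGaloisOuterConj, hτ₁, ← hσ]
    group
  have hy : y = absGaloisOuterConj F E₂ τ₂⁻¹ (absGaloisRestrict E₂ L σ) := by
    apply absGaloisRestrict_injective F E₂
    rw [absGaloisRestrict_absGaloisOuterConj, hτ₂, ← hxy, ← hσ]
    group
  have h1 : ρ₁ x = M₁⁻¹ * ρ₁ (absGaloisRestrict E₁ L σ) * M₁ := by
    have e := congrArg (fun ρ : FramedGaloisRep E₁ A n => ρ (absGaloisRestrict E₁ L σ)) hM₁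
    simp only [FramedRep.conj_apply, FramedGaloisRep.outerConj_apply] at e
    rw [hx, e]
    group
  have h2 : ρ₂ y = M₂⁻¹ * ρ₂ (absGaloisRestrict E₂ L σ) * M₂ := by
    have e := congrArg (fun ρ : FramedGaloisRep E₂ A n => ρ (absGaloisRestrict E₂ L σ)) hM₂
    simp only [FramedRep.conj_apply, FramedGaloisRep.outerConj_apply] at e
    rw [hy, e]
    group
  have h3 : ρ₂ (absGaloisRestrict E₂ L σ) = Q * ρ₁ (absGaloisRestrict E₁ L σ) * Q⁻¹ := by
    have e := congrArg (fun ρ : FramedGaloisRep L A n => ρ σ) hQ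
    simpa only [FramedRep.conj_apply, FramedGaloisRep.restrictField_apply] using e
  rw [h2, h3, h1]
  group

end Bridge

end SorensenPatching

end Literature.NumberTheory.GaloisRepresentations
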